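import Mathlib.Analysis.Normed.Ring.InfiniteSum
import Mathlib.Analysis.SpecificLimits.Normed
import Mathlib.NumberTheory.LSeries.PrimesInAP
import Literature.Barriers.Parity.SiegelZeroPrimePairs
import Literature.NumberTheory.Sieve.ParityWave0
import HarnessLib

/-!
# Goldston–Suriajaya, Theorem 1: the power-series generating functions (§2), proved

Sibling of `Literature/Barriers/Parity/SiegelZeroPrimePairs.lean` (Goldston–Suriajaya,
*Note on the Goldbach conjecture and Landau–Siegel zeros*, arXiv:2104.09407; Theorem 1 is the
tree's named fact `Literature.Barriers.Parity.GoldstonSuriajaya2021_goldbach`). Everything in this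
file is PROVED. It formalises §2 of the source ("Evaluating `𝒮(q)` in two ways") for a real
weight `0 ≤ ρ < 1` (the source takes `ρ = r = e^{−1/N}`):

* `psiGen q b ρ = Ψ(ρ; q, b) = ∑_{n ≡ b (mod q)} Λ(n) ρⁿ` (GS21 (Psi(r)));
* `genPairSum q ρ = 𝒮 = ∑_{b mod q} Ψ(ρ; q, b) Ψ(ρ; q, −b)` (GS21 (Sq2), taken as the definition);
* `genPairSum_eq_tsum` — `𝒮 = ∑_{k} ψ₂(qk) ρ^{qk}` with `ψ₂(n) = ∑_{m + m' = n} Λ(m)Λ(m')` the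
  tree's `Literature.NumberTheory.Sieve.goldbachLambdaCount` (GS21 (Sq1): "`𝒮(q) = ∑_{q ∣ n} ψ₂(n) rⁿ`";
  here by the Cauchy product and `∑_b 𝟙_{m ≡ b} 𝟙_{m' ≡ −b} = 𝟙_{q ∣ m + m'}`, instead of the
  roots of unity `(1/q)∑_a e(an/q) = 𝟙_{q ∣ n}` of the source — "we are also able to remove the
  need for Gaussian sums");
* `tsum_mul_pow_eq` — Abel summation for power series, `∑ aₙ xⁿ = (1 − x) ∑ Aₙ xⁿ`,
  `Aₙ = ∑_{k ≤ n} a_k`, and its instance `psiGen_eq_chebyshev`: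
  `Ψ(ρ; q, b) = (1 − ρ) ∑_n ψ(n; q, b) ρⁿ` (the partial summation of GS21 §4, display before
  (gamma)), with `ψ(x; q, b)` the tree's `Literature.NumberTheory.Sieve.ParityWave0.chebyshevPsiMod`.

The two evaluations of `𝒮` (GS21 §3 from the Weak Hardy–Littlewood–Goldbach Conjecture, §4 from
the prime number theorem for progressions with the exceptional-zero term) and the deduction of
Theorem 1 are in the sibling files `SiegelZeroGoldbachSingular.lean`,
`SiegelZeroGoldbachPrimeSide.lean`, `SiegelZeroGoldbachTheorem1.lean`.

## References

* D. A. Goldston, A. I. Suriajaya, *Note on the Goldbach conjecture and Landau–Siegel zeros*,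
  arXiv:2104.09407 (2021), §2: (Psi), (Psi^2), (Sq), (Sq1), (Psi(r)), (Sq2); §4 (partial
  summation). [cite: GoldstonSuriajaya2021, §2]
-/

noncomputable section

open Finset Real
open scoped ArithmeticFunction.vonMangoldt

namespace Literature.Barriers.Parity

namespace GoldstonSuriajaya

open Literature.NumberTheory.Sieve

/-! ### Crude size bounds and summability against `ρⁿ` -/

/-- `Λ(n) ≤ n`. [folklore] -/
theorem vonMangoldt_le_self (n : ℕ) : Λ n ≤ n := by
  rcases Nat.eq_zero_or_pos n with rfl | hn
  · simp
  · exact ArithmeticFunction.vonMangoldt_le_log.trans (Real.log_le_self (Nat.cast_nonneg n))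

/-- `0 ≤ ψ(n; q, b)`. [folklore] -/
theorem chebyshevPsiMod_nonneg (q : ℕ) (b : ZMod q) (x : ℝ) :
    0 ≤ ParityWave0.chebyshevPsiMod q b x :=
  sum_nonneg fun n _ => ArithmeticFunction.vonMangoldt.residueClass_nonneg b n

/-- `ψ(n; q, b) ≤ n²` for natural `n` (each of the `n + 1` terms `Λ(k)𝟙 ≤ k`). [folklore] -/
theorem chebyshevPsiMod_natCast_le_sq (q : ℕ) (b : ZMod q) (n : ℕ) :
    ParityWave0.chebyshevPsiMod q b n ≤ (n : ℝ) ^ 2 := by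
  rw [ParityWave0.chebyshevPsiMod, Nat.floor_natCast]
  calc ∑ k ∈ range (n + 1), ArithmeticFunction.vonMangoldt.residueClass b k ≤ ∑ k ∈ range (n + 1), (k : ℝ) :=
        sum_le_sum fun k _ => (ArithmeticFunction.vonMangoldt.residueClass_le b k).trans (vonMangoldt_le_self k)
    _ ≤ (n : ℝ) ^ 2 := by
        have h := congrArg (Nat.cast (R := ℝ)) (sum_range_id_mul_two (n + 1))
        push_cast at h
        have hn : (n : ℝ) ≤ (n : ℝ) ^ 2 := by exact_mod_cast Nat.le_self_pow two_ne_zero n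
        nlinarith

/-- `∑ n^k ρⁿ` converges for `0 ≤ ρ < 1`. [folklore] -/
theorem summable_pow_mul_pow {ρ : ℝ} (hρ0 : 0 ≤ ρ) (hρ1 : ρ < 1) (k : ℕ) :
    Summable (fun n : ℕ => (n : ℝ) ^ k * ρ ^ n) :=
  summable_pow_mul_geometric_of_norm_lt_one k (by rwa [Real.norm_of_nonneg hρ0])

/-- Comparison: `0 ≤ f(n) ≤ C n^k` makes `∑ f(n) ρⁿ` converge for `0 ≤ ρ < 1`. [folklore] -/
theorem summable_mul_pow_of_le {f : ℕ → ℝ} {ρ C : ℝ} (hρ0 : 0 ≤ ρ) (hρ1 : ρ < 1) (k : ℕ)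
    (h0 : ∀ n, 0 ≤ f n) (hle : ∀ n, f n ≤ C * (n : ℝ) ^ k) :
    Summable (fun n : ℕ => f n * ρ ^ n) := by
  refine ((summable_pow_mul_pow hρ0 hρ1 k).mul_left C).of_nonneg_of_le
    (fun n => mul_nonneg (h0 n) (pow_nonneg hρ0 n)) fun n => ?_
  rw [← mul_assoc]
  exact mul_le_mul_of_nonneg_right (hle n) (pow_nonneg hρ0 n)

/-! ### Abel summation for power series -/

/-- **Abel summation for power series.** If `Aₙ = ∑_{k ≤ n} a_k` and `∑ Aₙ xⁿ` converges, then
`∑ aₙ xⁿ = (1 − x) ∑ Aₙ xⁿ` (and `∑ aₙ xⁿ` converges). This is the partial summation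
`Ψ(r; q, b) = ∫ e^{−u/N} dψ(u; q, b)` of GS21 §4 in discrete form. [folklore] -/
theorem summable_mul_pow_of_summable_sum {a : ℕ → ℝ} {x : ℝ}
    (hA : Summable (fun n : ℕ => (∑ k ∈ range (n + 1), a k) * x ^ n)) :
    Summable (fun n : ℕ => a n * x ^ n) := by
  rw [← summable_nat_add_iff 1]
  have h1 : Summable (fun n : ℕ => (∑ k ∈ range (n + 1 + 1), a k) * x ^ (n + 1)) :=
    (summable_nat_add_iff 1).mpr hA
  have h2 : Summable (fun n : ℕ => x * ((∑ k ∈ range (n + 1), a k) * x ^ n)) := hA.mul_left x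
  convert h1.sub h2 using 1
  ext n
  rw [sum_range_succ _ (n + 1)]
  ring

/-- **Abel summation for power series**: `∑ aₙ xⁿ = (1 − x) ∑ Aₙ xⁿ`, `Aₙ = ∑_{k ≤ n} a_k`,
whenever `∑ Aₙ xⁿ` converges. [folklore] -/
theorem tsum_mul_pow_eq {a : ℕ → ℝ} {x : ℝ}
    (hA : Summable (fun n : ℕ => (∑ k ∈ range (n + 1), a k) * x ^ n)) :
    ∑' n : ℕ, a n * x ^ n = (1 - x) * ∑' n : ℕ, (∑ k ∈ range (n + 1), a k) * x ^ n := by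
  set A : ℕ → ℝ := fun n => ∑ k ∈ range (n + 1), a k with hAdef
  have ha : Summable (fun n : ℕ => a n * x ^ n) := summable_mul_pow_of_summable_sum hA
  have h1 : Summable (fun n : ℕ => A (n + 1) * x ^ (n + 1)) := (summable_nat_add_iff 1).mpr hA
  have h2 : Summable (fun n : ℕ => x * (A n * x ^ n)) := hA.mul_left x
  calc ∑' n : ℕ, a n * x ^ n = a 0 * x ^ 0 + ∑' n : ℕ, a (n + 1) * x ^ (n + 1) :=
        ha.tsum_eq_zero_add
    _ = A 0 * x ^ 0 + ∑' n : ℕ, (A (n + 1) * x ^ (n + 1) - x * (A n * x ^ n)) := by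
        congr 1
        · simp [hAdef]
        · refine tsum_congr fun n => ?_
          simp only [hAdef]
          rw [sum_range_succ _ (n + 1)]
          ring
    _ = A 0 * x ^ 0 + (∑' n : ℕ, A (n + 1) * x ^ (n + 1) - ∑' n : ℕ, x * (A n * x ^ n)) := by
        rw [h1.tsum_sub h2]
    _ = (A 0 * x ^ 0 + ∑' n : ℕ, A (n + 1) * x ^ (n + 1)) - x * ∑' n : ℕ, A n * x ^ n := by
        rw [tsum_mul_left]
        ring
    _ = ∑' n : ℕ, A n * x ^ n - x * ∑' n : ℕ, A n * x ^ n := by rw [← hA.tsum_eq_zero_add]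
    _ = (1 - x) * ∑' n : ℕ, A n * x ^ n := by ring

/-! ### The generating functions `Ψ(ρ; q, b)` and the pair sum `𝒮` -/

/-- `Ψ(ρ; q, b) = ∑_{n ≡ b (mod q)} Λ(n) ρⁿ`, the power-series generating function of the primes
in the class `b (mod q)` (GS21 (Psi(r)) with `r = ρ`). [cite: GoldstonSuriajaya2021, §2 (Psi(r))] -/
def psiGen (q : ℕ) (b : ZMod q) (ρ : ℝ) : ℝ :=
  ∑' n : ℕ, ArithmeticFunction.vonMangoldt.residueClass b n * ρ ^ n

/-- `𝒮 = ∑_{b mod q} Ψ(ρ; q, b) Ψ(ρ; q, −b)` (GS21 (Sq2); in the source this is the second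
expression for `𝒮(q) = (1/q)∑_a Ψ(re(a/q))²`). [cite: GoldstonSuriajaya2021, §2 (Sq2)] -/
def genPairSum (q : ℕ) [NeZero q] (ρ : ℝ) : ℝ :=
  ∑ b : ZMod q, psiGen q b ρ * psiGen q (-b) ρ

variable {ρ : ℝ}

/-- The terms `Λ(n)𝟙_{n ≡ b} ρⁿ` are absolutely summable for `0 ≤ ρ < 1`. [folklore] -/
theorem summable_norm_residueClass_mul_pow (q : ℕ) (b : ZMod q) (hρ0 : 0 ≤ ρ) (hρ1 : ρ < 1) :
    Summable (fun n : ℕ => ‖ArithmeticFunction.vonMangoldt.residueClass b n * ρ ^ n‖) := by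
  have h : Summable (fun n : ℕ => ArithmeticFunction.vonMangoldt.residueClass b n * ρ ^ n) :=
    summable_mul_pow_of_le hρ0 hρ1 1 (fun n => ArithmeticFunction.vonMangoldt.residueClass_nonneg b n) fun n => by
      rw [one_mul, pow_one]
      exact (ArithmeticFunction.vonMangoldt.residueClass_le b n).trans (vonMangoldt_le_self n)
  refine h.congr fun n => ?_
  rw [Real.norm_of_nonneg (mul_nonneg (ArithmeticFunction.vonMangoldt.residueClass_nonneg b n) (pow_nonneg hρ0 n))]

/-- `Ψ(ρ; q, b) ≥ 0`. [folklore] -/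
theorem psiGen_nonneg (q : ℕ) (b : ZMod q) (hρ0 : 0 ≤ ρ) : 0 ≤ psiGen q b ρ :=
  tsum_nonneg fun n => mul_nonneg (ArithmeticFunction.vonMangoldt.residueClass_nonneg b n) (pow_nonneg hρ0 n)

/-- `ψ₂(n) = ∑_{m + m' = n} Λ(m)Λ(m') ≥ 0`. [folklore] -/
theorem goldbachLambdaCount_nonneg (n : ℕ) : 0 ≤ goldbachLambdaCount n :=
  sum_nonneg fun _ _ => mul_nonneg ArithmeticFunction.vonMangoldt_nonneg ArithmeticFunction.vonMangoldt_nonneg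

/-- `ψ₂(n) ≤ (n + 1) n²` (crude: `n + 1` terms, each `≤ n · n`). [folklore] -/
theorem goldbachLambdaCount_le (n : ℕ) : goldbachLambdaCount n ≤ ((n : ℝ) + 1) * (n : ℝ) ^ 2 := by
  unfold goldbachLambdaCount
  have hterm : ∀ ab ∈ antidiagonal n, Λ ab.1 * Λ ab.2 ≤ (n : ℝ) ^ 2 := by
    intro ab hab
    rw [Finset.HasAntidiagonal.mem_antidiagonal] at hab
    have h1 : Λ ab.1 ≤ n := (vonMangoldt_le_self _).trans (by exact_mod_cast hab ▸ Nat.le_add_right _ _)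
    have h2 : Λ ab.2 ≤ n := (vonMangoldt_le_self _).trans (by exact_mod_cast hab ▸ Nat.le_add_left _ _)
    rw [sq]
    exact mul_le_mul h1 h2 ArithmeticFunction.vonMangoldt_nonneg (Nat.cast_nonneg n)
  calc ∑ ab ∈ antidiagonal n, Λ ab.1 * Λ ab.2 ≤ ∑ _ab ∈ antidiagonal n, (n : ℝ) ^ 2 := sum_le_sum hterm
    _ = ((n : ℝ) + 1) * (n : ℝ) ^ 2 := by
        rw [sum_const, Finset.Nat.card_antidiagonal, nsmul_eq_mul]
        push_cast
        ring

/-- Orthogonality without characters: `∑_{b mod q} Λ(m)𝟙_{m ≡ b} · Λ(m')𝟙_{m' ≡ −b} =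
𝟙_{q ∣ m + m'} Λ(m)Λ(m')` (replacing `(1/q)∑_a e(a(m + m')/q) = 𝟙_{q ∣ m + m'}` of GS21 (Sq1)).
[cite: GoldstonSuriajaya2021, §2 (Sq1)–(Sq2)] -/
theorem sum_residueClass_mul_residueClass_neg (q : ℕ) [NeZero q] (m m' : ℕ) :
    ∑ b : ZMod q, ArithmeticFunction.vonMangoldt.residueClass b m * ArithmeticFunction.vonMangoldt.residueClass (-b) m' =
      if q ∣ m + m' then Λ m * Λ m' else 0 := by
  have hind : ∀ (b : ZMod q) (k : ℕ),
      ArithmeticFunction.vonMangoldt.residueClass b k = if (k : ZMod q) = b then Λ k else 0 := by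
    intro b k
    simp only [ArithmeticFunction.vonMangoldt.residueClass, Set.indicator_apply, Set.mem_setOf_eq]
  simp_rw [hind]
  rw [Finset.sum_eq_single (m : ZMod q)]
  · rw [if_pos rfl]
    have hiff : ((m' : ZMod q) = -(m : ZMod q)) ↔ q ∣ m + m' := by
      rw [← ZMod.natCast_eq_zero_iff, Nat.cast_add, eq_neg_iff_add_eq_zero, add_comm]
    by_cases h : q ∣ m + m'
    · rw [if_pos (hiff.mpr h), if_pos h]
    · rw [if_neg (fun h' => h (hiff.mp h')), if_neg h, mul_zero]
  · intro b _ hb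
    rw [if_neg (Ne.symm hb), zero_mul]
  · intro h
    exact absurd (mem_univ _) h

/-- **GS21 (Sq1) = (Sq2)**: `∑_b Ψ(ρ; q, b)Ψ(ρ; q, −b) = ∑_n 𝟙_{q ∣ n} ψ₂(n) ρⁿ` for `0 ≤ ρ < 1`
(Cauchy product of the two absolutely convergent power series, then orthogonality).
[cite: GoldstonSuriajaya2021, §2 (Sq1), (Sq2)] -/
theorem genPairSum_eq_tsum_ite (q : ℕ) [NeZero q] (hρ0 : 0 ≤ ρ) (hρ1 : ρ < 1) :
    genPairSum q ρ = ∑' n : ℕ, (if q ∣ n then goldbachLambdaCount n else 0) * ρ ^ n := by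
  unfold genPairSum psiGen
  -- Cauchy product, class by class
  have hprod : ∀ b : ZMod q,
      (∑' n : ℕ, ArithmeticFunction.vonMangoldt.residueClass b n * ρ ^ n) *
          (∑' n : ℕ, ArithmeticFunction.vonMangoldt.residueClass (-b) n * ρ ^ n) =
        ∑' n : ℕ, ∑ kl ∈ antidiagonal n,
          ArithmeticFunction.vonMangoldt.residueClass b kl.1 * ρ ^ kl.1 * (ArithmeticFunction.vonMangoldt.residueClass (-b) kl.2 * ρ ^ kl.2) :=
    fun b => tsum_mul_tsum_eq_tsum_sum_antidiagonal_of_summable_norm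
      (summable_norm_residueClass_mul_pow q b hρ0 hρ1)
      (summable_norm_residueClass_mul_pow q (-b) hρ0 hρ1)
  have hsum : ∀ b : ZMod q, Summable (fun n : ℕ => ∑ kl ∈ antidiagonal n,
      ArithmeticFunction.vonMangoldt.residueClass b kl.1 * ρ ^ kl.1 * (ArithmeticFunction.vonMangoldt.residueClass (-b) kl.2 * ρ ^ kl.2)) :=
    fun b => (summable_norm_sum_mul_antidiagonal_of_summable_norm
      (summable_norm_residueClass_mul_pow q b hρ0 hρ1)
      (summable_norm_residueClass_mul_pow q (-b) hρ0 hρ1)).of_norm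
  simp_rw [hprod]
  rw [← Summable.tsum_finsetSum (fun b _ => hsum b)]
  refine tsum_congr fun n => ?_
  rw [sum_comm]
  have hinner : ∀ kl ∈ antidiagonal n,
      ∑ b : ZMod q, ArithmeticFunction.vonMangoldt.residueClass b kl.1 * ρ ^ kl.1 *
          (ArithmeticFunction.vonMangoldt.residueClass (-b) kl.2 * ρ ^ kl.2) =
        (if q ∣ n then Λ kl.1 * Λ kl.2 else 0) * ρ ^ n := by
    intro kl hkl
    rw [Finset.HasAntidiagonal.mem_antidiagonal] at hkl
    calc ∑ b : ZMod q, ArithmeticFunction.vonMangoldt.residueClass b kl.1 * ρ ^ kl.1 *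
            (ArithmeticFunction.vonMangoldt.residueClass (-b) kl.2 * ρ ^ kl.2)
        = (∑ b : ZMod q, ArithmeticFunction.vonMangoldt.residueClass b kl.1 * ArithmeticFunction.vonMangoldt.residueClass (-b) kl.2) *
            ρ ^ n := by
          rw [sum_mul]
          refine sum_congr rfl fun b _ => ?_
          rw [← hkl, pow_add]
          ring
      _ = (if q ∣ n then Λ kl.1 * Λ kl.2 else 0) * ρ ^ n := by
          rw [sum_residueClass_mul_residueClass_neg, hkl]
  rw [sum_congr rfl hinner, ← sum_mul]
  congr 1
  unfold goldbachLambdaCount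
  split_ifs
  · rfl
  · exact sum_const_zero

/-- A series supported on the multiples of `q ≥ 1` is a series over `k ↦ qk`. [folklore] -/
theorem tsum_ite_dvd_eq {q : ℕ} (hq : 0 < q) (F : ℕ → ℝ) :
    ∑' n : ℕ, (if q ∣ n then F n else 0) = ∑' k : ℕ, F (q * k) := by
  have hinj : Function.Injective (fun k : ℕ => q * k) := fun a b h => Nat.eq_of_mul_eq_mul_left hq h
  rw [← hinj.tsum_eq]
  · exact tsum_congr fun k => by simp
  · intro n hn
    rw [Function.mem_support] at hn
    by_cases h : q ∣ n
    · obtain ⟨k, rfl⟩ := h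
      exact ⟨k, rfl⟩
    · exact absurd (if_neg h) hn

/-- **GS21 (Sq1)**: `𝒮 = ∑_k ψ₂(qk) (ρ^q)^k` for `0 ≤ ρ < 1` ("on taking `n = qk`").
[cite: GoldstonSuriajaya2021, §2 (Sq1) and §3] -/
theorem genPairSum_eq_tsum (q : ℕ) [NeZero q] (hρ0 : 0 ≤ ρ) (hρ1 : ρ < 1) :
    genPairSum q ρ = ∑' k : ℕ, goldbachLambdaCount (q * k) * (ρ ^ q) ^ k := by
  rw [genPairSum_eq_tsum_ite q hρ0 hρ1]
  have h := tsum_ite_dvd_eq (NeZero.pos q) (fun n => goldbachLambdaCount n * ρ ^ n)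
  simp_rw [← pow_mul]
  rw [← h]
  refine tsum_congr fun n => ?_
  split_ifs <;> simp

/-- The pair-count series `∑_k ψ₂(qk) x^k` converges for `0 ≤ x < 1`. [folklore] -/
theorem summable_goldbachLambdaCount_mul_pow (q : ℕ) {x : ℝ} (hx0 : 0 ≤ x) (hx1 : x < 1) :
    Summable (fun k : ℕ => goldbachLambdaCount (q * k) * x ^ k) := by
  refine summable_mul_pow_of_le hx0 hx1 3 (C := ((q : ℝ) + 1) ^ 3)
    (fun k => goldbachLambdaCount_nonneg _) fun k => ?_
  refine (goldbachLambdaCount_le _).trans ?_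
  have hk : (0 : ℝ) ≤ k := Nat.cast_nonneg k
  have hq : (0 : ℝ) ≤ q := Nat.cast_nonneg q
  push_cast
  rcases Nat.eq_zero_or_pos k with rfl | hk1
  · simp
  · have hk1' : (1 : ℝ) ≤ k := by exact_mod_cast hk1
    have h1 : (q : ℝ) * k + 1 ≤ ((q : ℝ) + 1) * k := by nlinarith
    calc ((q : ℝ) * k + 1) * ((q : ℝ) * k) ^ 2 ≤ (((q : ℝ) + 1) * k) * (((q : ℝ) + 1) * k) ^ 2 := by
          gcongr
          nlinarith
      _ = ((q : ℝ) + 1) ^ 3 * (k : ℝ) ^ 3 := by ring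

/-! ### `Ψ(ρ; q, b)` by partial summation -/

/-- `∑_n ψ(n; q, b) ρⁿ` converges for `0 ≤ ρ < 1`. [folklore] -/
theorem summable_chebyshevPsiMod_mul_pow (q : ℕ) (b : ZMod q) (hρ0 : 0 ≤ ρ) (hρ1 : ρ < 1) :
    Summable (fun n : ℕ => ParityWave0.chebyshevPsiMod q b n * ρ ^ n) :=
  summable_mul_pow_of_le hρ0 hρ1 2 (C := 1) (fun n => chebyshevPsiMod_nonneg q b n) fun n => by
    rw [one_mul]
    exact chebyshevPsiMod_natCast_le_sq q b n

/-- **GS21 §4, partial summation**: `Ψ(ρ; q, b) = (1 − ρ) ∑_n ψ(n; q, b) ρⁿ` for `0 ≤ ρ < 1`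
(the discrete form of `Ψ(r; q, b) = ∫ e^{−u/N} dψ(u; q, b)`).
[cite: GoldstonSuriajaya2021, §4 (display before (gamma))] -/
theorem psiGen_eq_chebyshev (q : ℕ) (b : ZMod q) (hρ0 : 0 ≤ ρ) (hρ1 : ρ < 1) :
    psiGen q b ρ = (1 - ρ) * ∑' n : ℕ, ParityWave0.chebyshevPsiMod q b n * ρ ^ n := by
  have hcheb : ∀ n : ℕ, ParityWave0.chebyshevPsiMod q b n =
      ∑ k ∈ range (n + 1), ArithmeticFunction.vonMangoldt.residueClass b k := by
    intro n
    rw [ParityWave0.chebyshevPsiMod, Nat.floor_natCast]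
  simp_rw [hcheb]
  unfold psiGen
  refine tsum_mul_pow_eq ?_
  simp_rw [← hcheb]
  exact summable_chebyshevPsiMod_mul_pow q b hρ0 hρ1

end GoldstonSuriajaya

end Literature.Barriers.Parity
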